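import Mathlib
import HarnessLib
import HarnessLib.Audit
import Summits.AnomalousDissipation.Statement
import Literature.Analysis.FluidPDE.StatisticalSolution
import Literature.Analysis.FluidPDE.StokesTorus
import Literature.Analysis.FunctionSpaces.TorusSobolevSpace
import Literature.Analysis.FluidPDE.LerayHopf
import Literature.Analysis.FluidPDE.ZerothLaw
import HarnessLib.Audit.Status.Attr

/-!
Route: FrustratedForces

DORMANT since 2026-08-23T04:05:20Z (reconciler: no traction for 5.9 d (last activity item-evidence-added at 2026-08-17T06:15:07Z); parked, not closed — `ledger route dormant route-AnomalousDissipation-FrustratedForces --off` to reactiva) — unstaffed, not closed; items shared with open routes are served there. `ledger route dormant <id> --off` reactivates.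

Route FrustratedForces — realises idea card frustrated-forces-resonant-skeletons
(AnomalousDissipation/AnomalousDissipation).

THESIS X (words). Fix ONE explicit force, the Galloway–Proctor/Archontis force
  f_GP(x) = (sin 2πx₃, sin 2πx₁, sin 2πx₂)  on T³ = (ℝ/ℤ)³
(smooth, divergence-free, mean-zero, a Stokes eigenfield of the first shell that is NOT a steady
Euler
state: (f·∇)f is not a gradient; f_GP = f⁺ + f⁻ with f^± = (f ± curl f/2π)/2 the two ABC₁₁₁ Beltrami
fields of opposite chirality; zero mean helicity). X := the zeroth law holds WITH THIS FORCE: there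
are
ν_j → 0 and global Leray–Hopf solutions u_j of NS_{ν_j} forced by f_GP with sup_j ⟨‖u_j‖²⟩ < ∞ and
inf_j ν_j⟨‖∇u_j‖²⟩ > 0 (⟨·⟩ = limsup long-time mean, the summit's own functionals meanEnergy /
meanDissipation). X → AnomalousDissipation is ∃-introduction with f := f_GP — item
GPZerothLawClosesStatement : GPZerothLaw → AnomalousDissipation (frame #1, X → Statement; its proof
is the admissibility of
f_GP, item GPForceAdmissible, followed by ∃-intro); the cruxes reach X by item
GPLoudCruxesGiveZerothLaw : GPLoudEnergyCeilingZ → GPLoudFamilyZ → GPZerothLaw (ROUTE CHOICE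
2026-08-16, target-unreachable
repair: both glue items are SUPPORT and provable now — planner Sketch.lean / Sketch2.lean rc 0,
axioms
propext/Classical.choice/Quot.sound — and closes hF hC hL = GPZerothLawClosesStatement
(GPLoudCruxesGiveZerothLaw hC hL),
GPZerothLawClosesStatement being obtained from hF : GPForceAdmissible in 4 lines).

THESIS X (Lean, one line; elaborates rc 0 in planner Sketch.lean, decl GPZerothLaw):
∃ (ν : ℕ → ℝ) (u₀ : ℕ → T³ → E³) (u : ℕ → ℝ → T³ → E³), (∀ j, 0 < ν j) ∧ Tendsto ν atTop (nhds 0) ∧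
 (∀ j, Literature.Analysis.FluidPDE.Torus.IsGlobalLerayHopf (ν j) (fun _ => fGP) (u₀ j) (u j)) ∧
 (∃ E, ∀ j, Literature.Analysis.FluidPDE.meanEnergy (u j) ≤ E) ∧ ∃ ε > 0, ∀ j, ε ≤
Literature.Analysis.FluidPDE.meanDissipation (ν j) (u j)
where fGP is written inline as the sum of three accepted Stokes modes
 Literature.Analysis.FluidPDE.Torus.stokesMode (Pi.single 2 1) (EuclideanSpace.single 0 1) false +
stokesMode (Pi.single 0 1) (EuclideanSpace.single 1 1) false + stokesMode (Pi.single 1 1)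
(EuclideanSpace.single 2 1) false
(stokesMode k a false x = sin(2π k·x) a; all constants exist: lean search --decl stokesMode /
IsGlobalLerayHopf / meanEnergy / meanDissipation).

WHY ONE FORCE. The summit's two clauses (bounded energy; dissipation floor) are filed in the other
routes
as ∃f-statements that cannot be glued (Correlation 0201 vs 0203: different witnesses f). Pinning f
makes
ENERGY and LOUDNESS separately attackable and trivially gluable:
  closes : GPForceAdmissible → GPLoudEnergyCeilingZ → GPLoudFamilyZ → AnomalousDissipation   (the
deciding theorem,
  7 lines, certified by the gate audit; both cruxes range over ZERO-MEAN data, i.e. over the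
physical phase space H;
  it factors through X: GPLoudEnergyCeilingZ → GPLoudFamilyZ → GPZerothLaw → AnomalousDissipation,
the last arrow by GPForceAdmissible).
ROUTE CHOICE 2026-08-15. The any-mean ceiling GPEnergyCeiling (stmt-2979) was refuted by a
Galilean-drift datum
(Theorems.FrustratedForcesGPEnergyCeiling_refuted: constant datum of large mean, mean flow
conserved) — misstated in
substance, the refuter's FIX = zero-mean data, installed rev 4–6. Since then the hub's Galerkin
census of the GP steady
variety (kit j001684/j001712/j001732, card big-dodgers-odd-puiseux-ladder) found warm QUIET runaway
ends of the Stokes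
arc, ‖u‖ ≍ ν^{-1/3} with loudness ×0.80 per octave, at six truncations (continuum fate open: route
MirrorVariety). A
ceiling over ALL zero-mean Leray–Hopf solutions (GPEnergyCeilingZ, stmt-10420) is therefore at
concrete risk and is
more than closes needs; it is kept only as the ladder's top rung (dropped from the wants). The
energy crux of the line
is LOUD-SELECTIVE: GPLoudEnergyCeilingZ — ∀ ε₀ > 0 ∃ E ∀ ν ∈ (0,1]: every zero-mean Leray–Hopf
solution of NS_ν(f_GP)
with meanDissipation ≥ ε₀ has meanEnergy ≤ E ("for the frustrated force, sustained dissipation costs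
bounded
energy"; with GPLoudFamilyZ, ε₀ := ε, this is literally Kolmogorov's β = εℓ/U³ ≥ β₀ > 0 along the
loud family).
Warm wakes and dodgers are quiet and cannot touch it; only a hot-AND-loud branch (E ≍ ν^{-2a}, a ≥
1/2) can: a = 1 is
a resonant skeleton, excluded by frustration (crux GPSteadySubGrashof; the Kolmogorov control of
LaminarCalibration
is loud AND hot, ε = ‖f‖²/(16π⁴ν)), and a ∈ [1/2,1) is off the odd ladder 1/(2n+1) of algebraic
steady ends; the
negation of the crux would itself exhibit a loud fixed-force family with ν → 0, i.e. prove
GPLoudFamilyZ (the open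
loudness half, Cheskidov2023 §1.2) — it cannot die cheaply.
The card's mechanism says WHICH f to pin: a force can hoard Grashof-scale energy (‖u‖ ≍ ν⁻¹) only on
a
rescaled H¹ steady-Euler skeleton it resonates with, and the skeleton must pass a second-order
solvability
(Livšic/Newcomb torus-average) test; f_GP is "frustrated" — its Beltrami skeletons f^± fail the test
(f⁻·f⁺ has non-zero averages on the principal ABC vortices) and its shear skeletons fail by 3-D
lift-up — so
no laminar trap, no stable laminar state, no helicity injection: the natural arena for ν-UNIFORM
energy
statements on the physical phase space H (crux GPLoudEnergyCeilingZ), whose first falsifiable rung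
is the
sub-Grashof ceiling over steady states (crux GPSteadySubGrashof, the card's conjecture F1).

Lean: `∃ (ν : ℕ → ℝ) (u₀ : ℕ → UnitAddTorus (Fin 3) → EuclideanSpace ℝ (Fin 3)) (u : ℕ → ℝ →
UnitAddTorus (Fin 3) → EuclideanSpace ℝ (Fin 3)), (∀ j, 0 < ν j) ∧ Filter.Tendsto ν Filter.atTop
(nhds 0) ∧ (∀ j, Literature.Analysis.FluidPDE.Torus.IsGlobalLerayHopf (ν j) (fun _ => (fun x :
UnitAddTorus (Fin 3) => (Literature.Analysis.FluidPDE.Torus.stokesMode (Pi.single (2 : Fin 3) (1 :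
ℤ)) (EuclideanSpace.single (0 : Fin 3) (1 : ℝ)) false x +
Literature.Analysis.FluidPDE.Torus.stokesMode (Pi.single (0 : Fin 3) (1 : ℤ)) (EuclideanSpace.single
(1 : Fin 3) (1 : ℝ)) false x + Literature.Analysis.FluidPDE.Torus.stokesMode (Pi.single (1 : Fin 3)
(1 : ℤ)) (EuclideanSpace.single (2 : Fin 3) (1 : ℝ)) false x : EuclideanSpace ℝ (Fin 3)))) (u₀ j) (u
j)) ∧ (∃ E : ℝ, ∀ j, Literature.Analysis.FluidPDE.meanEnergy (u j) ≤ E) ∧ ∃ ε : ℝ, 0 < ε ∧ ∀ j, ε ≤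
Literature.Analysis.FluidPDE.meanDissipation (ν j) (u j)`

Rationale: WHY THIS LINE. Card frustrated-forces-resonant-skeletons; imports steady-Euler structure theory +
KAM/Livšic (Newcomb) solvability + hydrodynamic-stability lift-up, aimed at the ENERGY clause of the
summit. The only known way a fixed force stores the a-priori-maximal energy ‖u‖≍ν⁻¹
(FoiasManleyRosaTemam2001 (13.11), Ch. IV (1.32)–(1.34)) is a laminar state of a Stokes-eigen AND
Euler-steady force (Marchioro1986; item LaminarCalibration). Rescaling steady states by ν
(HoangJolly2024 Thm 4.7 / FoiasHoangJolly2024: v_n = u_n/(νκ₀G) is V-bounded and every limit solves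
B(v,v)=0) shows Grashof-scale energy needs a non-zero H¹ steady-Euler limit v positively resonant
with f (‖∇v‖² ≤ (f,v); item LaminarLimitCompactness), and the next order needs f − cAv ∈ Range
B_s(v,·): for Beltrami v this is Newcomb1959/Livšic solvability of v·∇B = g·v on every invariant
torus and ergodic component of v (DombreEtAl1986 geometry of ABC₁₁₁); for shear v it is inconsistent
by lift-up unless a VWI cross-sweep self-regularises (HallSherwin2010). f_GP = ABC⁺/2 + ABC⁻/2 fails
both tests explicitly ("frustrated"), so it is the force for which ν-UNIFORM energy statements on H
are most plausible (since the 2026-08-15 route choice: the LOUD-SELECTIVE ceiling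
GPLoudEnergyCeilingZ, see RANKED CRUXES); pinning f also makes the summit's energy and loudness
clauses gluable (they are ∃f-statements in Correlation 0201/0203 with possibly different witnesses),
and the deciding theorem closes is 7 lines (planner glue.lean). The negatives index holds the two
ANY-MEAN statements of this route (stmt-2979, stmt-2984, Galilean-drift witnesses); every active
item quantifies over zero-mean data and none restates them.
RANKED CRUXES. #2 GPSteadySubGrashof — sup over steady weak solutions of NS_ν(f_GP) of ν²‖u‖² → 0 as
ν → 0 (card F1; the first statement separating frustrated from resonant forces; the steady rung both
of the old universal ceiling and of #3, since a resonant a = 1 steady branch is loud AND hot;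
SUPPORTED by the hub's Galerkin census kit j001684/j001712/j001732: ν²E → 0 along every end found;
why it might fail: a VWI/critical-layer branch or an uncatalogued rough skeleton keeps ‖u‖≍ν⁻¹;
sources arXiv:2402.13346 Thm 4.3/4.5/4.7, HallSherwin2010, Newcomb1959, DombreEtAl1986). #3
GPLoudEnergyCeilingZ — ∀ε₀>0 ∃E ∀ν∈(0,1] ∀ ZERO-MEAN data ∀ global LH solutions u of NS_ν(f_GP):
meanDissipation ν u ≥ ε₀ → meanEnergy u ≤ E (hypothesis hC of closes; ROUTE CHOICE 2026-08-15:
replaces the universal zero-mean ceiling GPEnergyCeilingZ stmt-10420 — itself the repair of the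
any-mean GPEnergyCeiling stmt-2979, refuted-misstated by
Theorems.FrustratedForcesGPEnergyCeiling_refuted — because the census found warm QUIET runaway ends
‖u‖≍ν^{-1/3} of the GP Stokes arc at six truncations, card big-dodgers-odd-puiseux-ladder P3: any
ceiling over ALL LH solutions of a force with a continuum warm wake is false, so the energy
statement must be solution-selective; loud-selective is the weakest form that still glues verbatim
with #4 (E := E(ε)) and it is immune to quiet warm/dodger ends; GPEnergyCeilingZ → #3, Sketch.lean;
¬#3 ⇒ #4, since the witnesses are a loud zero-mean family forced to ν → 0 by the a-priori bound E ≤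
‖f‖²/(16π⁴ν²); why it might fail: a hot-AND-loud branch E≍ν^{-2a}, a ≥ 1/2 — a = 1 resonant (= ¬#2),
or an off-ladder a ∈ [1/2,1) unsteady/isola state; nothing in print bounds energy by dissipation for
any f ≠ 0, DoeringFoias2002 bounds ε by U only; 2-D: loud ⇒ hot, AlexakisDoering2006PLA). #4
GPLoudFamilyZ — ∃ε>0, ν_j→0 in (0,1], ZERO-MEAN data, LH solutions of NS_{ν_j}(f_GP) with
meanDissipation ≥ ε (hypothesis hL of closes; supersedes the any-mean GPLoudFamily stmt-2980,
dropped rev 4; why it might fail: every family might decorrelate or leak; 2-D analogue false,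
AlexakisDoering2006PLA; DNS only, BorueOrszag1996; no loud family is known for any fixed force,
Cheskidov2023 §1.2). DECIDING THEOREM closes (hF : GPForceAdmissible) (hC : GPLoudEnergyCeilingZ)
(hL : GPLoudFamilyZ) : AnomalousDissipation — take f := f_GP with the three admissibility facts; ε,
ν, u₀, u from hL (its ν_j ∈ (0,1], data zero-mean, meanDissipation ≥ ε); E from hC at ε₀ := ε,
applied at each j (planner glue.lean / Sketch.lean closes', rc 0, axioms
propext/Classical.choice/Quot.sound). Item Assembly (stmt-10541) is restated to the same chain and
is provable now by `fun hF hC hL => closes hF hC hL`. ROUTE CHOICE 2026-08-16 (operator hold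
target-unreachable: no item concluded the target): the target GPZerothLaw (X, stmt-2976, rank 0) is
now the WAIST of the route through two glue SUPPORT items — GPLoudCruxesGiveZerothLaw (stmt-14126) :
GPLoudEnergyCeilingZ → GPLoudFamilyZ → GPZerothLaw (cruxes #3, #4 ⇒ X: ε, ν, u₀, u from #4, E from
#3 at ε₀ := ε; the conditions ν_j ≤ 1 and zero-mean data are simply forgotten; PROVED in planner
Sketch.lean, 6 lines) and GPZerothLawClosesStatement (stmt-14127) : GPZerothLaw →
AnomalousDissipation (frame #1, X ⇒ summit: ∃-introduction with f := f_GP after the three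
admissibility facts of GPForceAdmissible — planner Sketch2.lean proves GPForceAdmissible →
GPZerothLawClosesStatement in 4 lines, so the item is exactly as hard as GPForceAdmissible, ~100–200
lines; it was first filed as GPForceAdmissible → GPZerothLaw → AnomalousDissipation and restated the
same day WITHOUT the route-local hypothesis because the gate renders support items in item-id order,
which put it above the decl GPForceAdmissible and blocked it); closes hF hC hL =
GPZerothLawClosesStatement (GPLoudCruxesGiveZerothLaw hC hL) with the first factor obtained from hF,
and Assembly follows from the two glue items alone.
SUPPORT. Provable now, rank 9: GPLoudCruxesGiveZerothLaw and GPZerothLawClosesStatement (the glue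
INTO and OUT OF the target X = GPZerothLaw, added at the 2026-08-16 route choice so that X is
reachable from the cruxes and the summit from X: the first is 6 lines of logic, the second is
GPForceAdmissible + 4 lines of ∃-introduction); GPForceAdmissible (smooth/div-free/mean-zero, first
hypothesis of closes and the whole content of GPZerothLawClosesStatement); LaminarLimitCompactness
(3-D: strong-L² subsequential limits U of ν·u_ν exist, lie in V, solve steady weak Euler and ‖∇U‖² ≤
(U,f)); RescaledSkeletonSSS (card R1 at the FMRT statistical level: ν²E ↛ 0 along stationary
statistical solutions ⇒ a unit-energy H¹ stationary statistical Euler solution with c∫‖∇v‖² ≤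
∫(f,v)); EnsembleCeilingBridgeZ (a ceiling over stationary statistical solutions of (ν,f) ⇒ the same
ceiling for meanEnergy of every LH solution FROM ZERO-MEAN DATA, via exists_timeAverageMeasure_holds
+ timeAverage_isStationary_holds; repairs EnsembleCeilingBridge stmt-2984, refuted-misstated by
Theorems.FrustratedForcesEnsembleCeilingBridge_refuted with f = 0 and a constant drift datum; known
in print, FMRT Ch. IV Rem. 1.5 + Prop. 3.2, grounder g19-12; after the route choice it serves the
universal rungs of the ladder and the statistical attack on #3, not closes); (𝒱 ⊆ V, used by
LaminarCalibration / SSS-level work, is DISCHARGED in tree: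
TorusSobolevSpaceProofs.smoothSolenoidal_subset_energySpaceV_holds — the marker item
SmoothSolenoidalInV stmt-4205 was dropped 2026-08-15 so the audited cone has 0 unproved facts);
LaminarCalibration (Kolmogorov shear force: the laminar branch has ν²‖u‖² ≡ 1/(32π⁴), so #2 is
force-specific by necessity).
KILL CRITERIA. ¬#2 (a GP steady branch with liminf ν‖u_ν‖ > 0, e.g. found by continuation in G and
certified — card F2) ⇒ such a branch is loud AND hot, so #3 is false too ⇒ close the route
refuted:GPSteadySubGrashof (frustration is dead for f_GP; census to Neg and Correlation 0204). ¬#3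
with #2 surviving (a hot-loud family at an intermediate rate, a ∈ [1/2,1)) ⇒ #4 is thereby PROVED
(the witnesses are a loud zero-mean family with ν → 0) and the energy claim is dead at the
Leray–Hopf level: pivot ONCE to the solution class of the loud witnesses that stay bounded (steady /
time-periodic: 'no hot-loud steady states of f_GP' + a loud steady GP family, glued by
MirrorVariety.SteadyWeakIsGlobalLerayHopf) if the census or the refutation shows one, else close
refuted:GPLoudEnergyCeilingZ. ¬#4 ⇒ close (f_GP is quiet; feeds Neg) — note ¬#4 makes #3 vacuously
true, which decides nothing. A refutation of the dropped strong form GPEnergyCeilingZ (stmt-10420,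
e.g. by a continuum warm wake, MirrorVariety / card big-dodgers K1) does NOT break this line: it is
expected and is recorded here in advance. The 2026-08-15 refutations of the any-mean GPEnergyCeiling
/ EnsembleCeilingBridge (Galilean drift of the datum) are MISSTATED-class and say nothing about the
line; they stay as negative edges. Proved elsewhere: Correlation 0203+0201 for the SAME f, or
CoherentStates 0219 / MirrorVariety GalerkinSteadyZerothLaw with witness force f_GP, moot #3/#4;
EnsembleNeg (0217) or Correlation 0204 proved ⇒ close.
NOT DECOMPOSED YET. The glued split of #2 (only after LaminarLimitCompactness lands — it is the
glue): BeltramiSkeletonExclusion (no non-zero first-shell curl-eigenfield is a strong-L² limit of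
ν·u_ν: the Livšic/Newcomb computation on the ABC₁₁₁ tubes) + ShearSkeletonExclusion (lift-up
inconsistency for unidirectional first-shell skeletons) + NoOtherSkeleton (Arnold's dichotomy
upgraded to the H¹ limits that occur); the statistical-level rung of #2 (all stationary statistical
solutions). For #3: its STEADY rung NoHotLoudSteadyGP (∀ε₀ ∃E ∀ν ∀ steady u ∈ V of NS_ν(f_GP):
(f_GP,u) = ν‖∇u‖² ≥ ε₀ ⇒ ‖u‖² ≤ E — exclusion of steady ends with a ∈ [1/2,1]; a = 1 is #2, a < 1 is
off the H¹-tight regime of LaminarLimitCompactness and needs the odd-ladder/curve-selection input of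
card big-dodgers K2), its statistical rung (time-average measures of loud trajectories are
stationary statistical solutions with mean dissipation ≥ ε₀ under uniform integrability — the
loud-selective twin of EnsembleCeilingBridgeZ), and the STRONG FORM GPEnergyCeilingZ (stmt-10420,
universal zero-mean ceiling = the ladder's top rung ν⁻² → ν^{-2/3} → O(1); dropped from the wants at
the route choice because the census makes a warm quiet GP branch plausible; re-want it only if
MirrorVariety's continuum alternative for f_GP resolves to 'dodger'); the mechanism for #4
(euler-coercive-force / lagrangian-echo cards specialised to f_GP; loud steady or periodic GP states
realised as LH via isGlobalLerayHopf_of_isClassicalNSSolutionOn_holds). Card F2 numerics and the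
census are kit evidence on #2/#3, not items. No constants, no rates.
TWO-LAYER PLAN. GPSteadySubGrashof ⇐ BeltramiSkeletonExclusion → ShearSkeletonExclusion →
NoOtherSkeleton → GPSteadySubGrashof, glue-by LaminarLimitCompactness (k = 3, depth 1).
GPLoudEnergyCeilingZ ⇐ GPLoudEnsembleCeiling (every stationary statistical solution of (ν, f_GP), ν
≤ 1, with ensemble dissipation ≥ ε₀ has ensembleEnergy ≤ E(ε₀)) → GPLoudEnergyCeilingZ, glue-by a
loud-selective EnsembleCeilingBridgeZ (k = 1+glue), foreseen only once #2 closes.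
CHEAPEST FALSIFIER. Newton–Krylov continuation in G = 1/ν² of the GP steady branch from u ≈
f_GP/(4π²ν) versus the Kolmogorov control (card F2): one GP branch with ν²‖u‖² ↛ 0 kills #2 and #3
(it is loud and hot). STATUS 2026-08-15: RUN at Galerkin level by card
big-dodgers-odd-puiseux-ladder (kit j001684/j001712/j001732, K² ≤ 14): ν²E → 0 along every end (a ∈
{1/3, 0}; the one a = 1 end, K² = 10, is a spurious resonant Galerkin-Euler profile) — consistent
with #2; the warm a = 1/3 ends are QUIET (loudness ×0.80 per octave) — consistent with #3 and the
reason the universal ceiling was demoted. The cheapest kill of #3 proper: monitor the loudness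
(f_GP,u) = ν‖∇u‖² along every continued GP branch whose energy grows — a branch with growing energy
and non-decaying loudness (a ≥ 1/2) kills #3. By hand, cheaper: the Livšic/Newcomb averages of
f⁻·ABC⁺ ∝ cos4πx₁+cos4πx₂+cos4πx₃ over the six principal ABC₁₁₁ vortices (DombreEtAl1986 §5) — if
all vanish, the card's Beltrami obstruction is void. Neither run here (compute-free hub, one-shot
pass).
DEFINITION REQUESTS. None: f_GP is written inline as a sum of three accepted Stokes modes
(Literature.Analysis.FluidPDE.Torus.stokesMode); stationary statistical solutions, steady weak
solutions, energySpace/energySpaceV, meanEnergy/meanDissipation all exist. A named abbreviation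
`gallowayProctorForce` would shorten eight signatures; optional, not requested.

Novelty: NOVELTY (planner plancard, 2026-08-15; searches run BEFORE this claim: `lit search --source
crossref` on
"Kolmogorov flows singular limit bifurcation Okamoto steady Navier-Stokes", "steady Navier-Stokes
large Grashof
number asymptotics body force energy", "Galerkin approximations Navier-Stokes limit of large Grashof
numbers",
"nonlinear stability of the 1:1:1 ABC flow", "three-dimensional Kolmogorov flow high Reynolds
numbers",
"magnetic differential equations Newcomb 1959", "two-dimensional vortex condensate high Reynolds
number",
"steady Navier-Stokes solutions torus inviscid limit steady Euler selection", "Archontis dynamo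
forcing
hydrodynamic steady state", "Galloway Proctor flow forcing turbulence"; `lit search --hybrid
--source local`
(FMRT Ch. IV support/energy bounds, PDF p.198 (1.31)–(1.34) READ); `lit galaxy search "Archontis
flow" --star all`
(1 hit: Sur–Brandenburg 2009, MHD saturation; galaxy read queue saturated, not read); `lit frontier
AnomalousDissipation --since 2020`, `lit bridges AnomalousDissipation --cross any` (no
steady-state/Grashof-scaling
entries); searchd/zbmath/openalex intermittently unavailable (rc 75 / HTTP 429) during the pass; the
card's own
refs and the refuter novelty audit (grade new-combination; prior art Okamoto1998, Kim–Okamoto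
2010/2015,
GalletYoung2013, Newcomb1959) re-read.)
NEAREST PRIOR ART ACTUALLY FOUND.
(1) HoangJolly2024 = arXiv:2402.13346 (Nonlinearity 37, READ §4) and FoiasHoangJolly2024 (CPAA 23,
doi:10.3934/cpaa.2024010): t  [refs: 10.3934/cpaa.2024010, 10.4171/dms/1-3/50, 10.1017/jfm.2012.524, 10.1063/1.1724405, 10.1016/0167-2789(94, 2402.13346, doi:10.3934/cpaa.2024010, doi:10.4171/dms/1-3/50, doi:10.1017/jfm.2012.524, doi:10.1063/1.1724405, doi:10.1016/0167-2789, Okamoto1998, GalletYoung2013, Newcomb1959, HoangJolly2024, FoiasHoangJolly2024, OkamotoShoji1993, PodviginaPouquet1994, ChildressKerswellGilbert2001, BorueOrszag]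

Barriers (technique_class: rescaled-skeleton-classification energy-ceiling one-force): - technique_class: rescaled-skeleton-classification energy-ceiling one-force
- Literature.Barriers.AnomalousDissipation.Marchioro1986_globalAttraction: APPLIES as the paradigm
to avoid — for a first-mode (Stokes-eigen AND Euler-steady) force every solution is attracted to the
laminar state with energy |f|²/(ν²λ₁²), so no universal energy ceiling holds for such f. Evaded by
the EXACT force: f_GP is Stokes-eigen but (f_GP·∇)f_GP is not a gradient, so f_GP/(4π²ν) is no
solution; item LaminarCalibration records the resonant control (Kolmogorov shear force: ν²‖u‖² ≡
1/(32π⁴)); cruxes #2/#3 are force-specific and deliberately NOT force-robust (a small Stokes-eigen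
Euler-steady addition to f is expected to destroy frustration).
- Literature.Barriers.AnomalousDissipation.AlexakisDoering2006_energyDissipationBound: APPLIES to #4
and, since the route choice, to #3 as a constraint — in 2-D ε ≲ k_fU³Re^{-1/2}, so LOUD ⇒ HOT (U⁵ ≳
ε₀²ℓ³/ν): the 2-D analogue of #4 is false and the 2-D analogue of #3 holds only vacuously (no loud
solutions) or fails (single-mode forces: laminar branch loud and hot); both cruxes must be genuinely
3-D; f_GP depends on all three coordinates with cyclically polarised components and has no
x₃-independent invariant reduction; consistent with the card: 2-D integrable skeletons pass the
solvability test (condensates), 3-D lift-up is the new ingredient.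
- Literature.Barriers.AnomalousDissipation.Cheskidov2023_thm13_not_forceRobustNoAnomaly: does not
apply to the pos

History (route lifecycle, newest last):
- 2026-08-15T16:18:07Z · rev 4: dropped GPLoudFamily — repair: GPEnergyCeiling (stmt-2979) and EnsembleCeilingBridge (stmt-2984) refuted-MISSTATED by Theorems.FrustratedForcesGPEnergyCeiling_refuted / FrustratedForc (planner-rbadge-AnomalousDissipation-Frustrated-193db9c0-g2-0)
- 2026-08-15T16:20:59Z · rev 5: dropped GPEnergyCeiling, EnsembleCeilingBridge — repair (2/2): drop the wants of the two refuted-MISSTATED items GPEnergyCeiling (stmt-2979, Theorems.FrustratedForcesGPEnergyCeiling_refuted @ ffffe9673610) and (planner-rbadge-AnomalousDissipation-Frustrated-193db9c0-g2-0)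
- 2026-08-15T16:20:59Z · REPAIRED (drop GPEnergyCeiling, EnsembleCeilingBridge) — back to open: repair (2/2): drop the wants of the two refuted-MISSTATED items GPEnergyCeiling (stmt-2979, Theorems.FrustratedForcesGPEnergyCeiling_refuted @ ffffe9673610) and (planner-rbadge-AnomalousDissipation-Frustrated-193db9c0-g2-0)
- 2026-08-15T16:22:26Z · rev 6: dropped SmoothSolenoidalInV — cone: drop the needs-fact marker SmoothSolenoidalInV (stmt-4205 := Torus.smoothSolenoidal_subset_energySpaceV (d := Fin 3)). The fact is DISCHARGED in tree (Lit (planner-rbadge-AnomalousDissipation-Frustrated-193db9c0-g2-0)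
- 2026-08-15T23:14:25Z · rev 9: restated Assembly (stmt-AnomalousDissipation-10541) — route-choice (unit rchoice-AnomalousDissipation-Frustrate-e6e54d4b): NEXT LINE. (1) The 2979 refutation (Theorems.FrustratedForcesGPEnergyCeiling_refuted) is mi (planner-rchoice-AnomalousDissipation-Frustrate-e6e54d4b-0)
- 2026-08-15T23:14:25Z · rev 9: dropped stmt-AnomalousDissipation-10420 — route-choice (unit rchoice-AnomalousDissipation-Frustrate-e6e54d4b): NEXT LINE. (1) The 2979 refutation (Theorems.FrustratedForcesGPEnergyCeiling_refuted) is mi (planner-rchoice-AnomalousDissipation-Frustrate-e6e54d4b-0)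
- 2026-08-16T03:24:25Z · rev 12: restated GPZerothLawClosesStatement (stmt-AnomalousDissipation-14127) — route-choice (a), step 2/2: restate the glue-out item GPZerothLawClosesStatement (stmt-14127) 1:1 as `GPZerothLaw → _root_.AnomalousDissipation` (frame #1, X → (planner-rchoice-AnomalousDissipation-Frustrate-d7bfbbb4-0)
- 2026-08-23T04:05:20Z · DORMANT — reconciler: no traction for 5.9 d (last activity item-evidence-added at 2026-08-17T06:15:07Z); parked, not closed — `ledger route dormant route-AnomalousDissipa (operator:999:378268)

sub-problem: AnomalousDissipation · status: dormant · opened planner-plancard-AnomalousDissipation-Anomalo-93bd912b-0 2026-08-15T11:09:48Z · rev 12 · ledger route-AnomalousDissipation-FrustratedForces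
GENERATED by the gate from the ledger (D-0016/17). Provers cite these decls: `theorem foo : Summit.AnomalousDissipation.AnomalousDissipation.Theses.FrustratedForces.<Decl> := …` in Summits/AnomalousDissipation/AnomalousDissipation/Theorems/<Name>.lean.
-/

namespace Summit.AnomalousDissipation.AnomalousDissipation.Theses.FrustratedForces

open scoped BigOperators Topology Manifold Classical MeasureTheory ProbabilityTheory Matrix InnerProductSpace ComplexConjugate ContinuousMap
open Filter Set Function TopologicalSpace MeasureTheory

attribute [summit_statement] _root_.AnomalousDissipation

open Literature.Turb

/-- item stmt-AnomalousDissipation-2976 · target · rank 0 · open · by planner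
why it might fail: It is the summit for one pinned force: f_GP may be quiet (all bounded-energy LH families decorrelate, as every 2-D force does: AlexakisDoering2006) or may still hoard energy on an uncatalogued skeleton; no fixed-force zeroth-law example is known (Cheskidov2023 §1.2; BrueDeLellis2023).
sources: Cheskidov2023, BrueDeLellis2023, AlexakisDoering2006PLA, FoiasManleyRosaTemam2001, DoeringFoias2002
[target] Thesis X of route FrustratedForces (idea card frustrated-forces-resonant-skeletons): the
zeroth law WITH THE EXPLICIT Galloway–Proctor/Archontis force f_GP(x) = (sin 2πx₃, sin 2πx₁, sin
2πx₂) = ABC⁺/2 + ABC⁻/2 (inline: sum of three accepted Stokes modes stokesMode (Pi.single 2 1) e₀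
false + stokesMode (Pi.single 0 1) e₁ false + stokesMode (Pi.single 1 1) e₂ false): ν_j → 0, global
Leray–Hopf u_j of NS_{ν_j}(f_GP) with sup_j meanEnergy < ∞ and inf_j meanDissipation > 0. X →
AnomalousDissipation by ∃-intro with f := f_GP (needs GPForceAdmissible). Conjunction of cruxes
GPEnergyCeiling (#3) and GPLoudFamily (#4). Why it might fail: it is the summit for one pinned force
— f_GP could be quiet (all LH families decorrelate) or could still hoard energy on an uncatalogued
skeleton. Sources: card; FoiasManleyRosaTemam2001 (13.11); DoeringFoias2002 §§2–3; Cheskidov2023 =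
arXiv:2311.04182 §1.2 ('no known example' at fixed force). -/
@[route_item "route-AnomalousDissipation-FrustratedForces"]
def GPZerothLaw : Prop :=
  ∃ (ν : ℕ → ℝ) (u₀ : ℕ → UnitAddTorus (Fin 3) → EuclideanSpace ℝ (Fin 3)) (u : ℕ → ℝ → UnitAddTorus (Fin 3) → EuclideanSpace ℝ (Fin 3)), (∀ j, 0 < ν j) ∧ Filter.Tendsto ν Filter.atTop (nhds 0) ∧ (∀ j, Literature.Analysis.FluidPDE.Torus.IsGlobalLerayHopf (ν j) (fun _ => (fun x : UnitAddTorus (Fin 3) => (Literature.Analysis.FluidPDE.Torus.stokesMode (Pi.single (2 : Fin 3) (1 : ℤ)) (EuclideanSpace.single (0 : Fin 3) (1 : ℝ)) false x + Literature.Analysis.FluidPDE.Torus.stokesMode (Pi.single (0 : Fin 3) (1 : ℤ)) (EuclideanSpace.single (1 : Fin 3) (1 : ℝ)) false x + Literature.Analysis.FluidPDE.Torus.stokesMode (Pi.single (1 : Fin 3) (1 : ℤ)) (EuclideanSpace.single (2 : Fin 3) (1 : ℝ)) false x : EuclideanSpace ℝ (Fin 3)))) (u₀ j) (u j)) ∧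 (∃ E : ℝ, ∀ j, Literature.Analysis.FluidPDE.meanEnergy (u j) ≤ E) ∧ ∃ ε : ℝ, 0 < ε ∧ ∀ j, ε ≤ Literature.Analysis.FluidPDE.meanDissipation (ν j) (u j)

/-- item stmt-AnomalousDissipation-2978 · crux · rank 2 · open · by planner
why it might fail: A GP steady branch may keep ν‖u‖↛0: HoangJolly2024 §4.2 gives ‖v_n‖≤|g| in 3-D but no relation deciding v=0 (Thm 4.7); v≠0 survives if the Newcomb/Livšic averages of f⁻·ABC⁺ vanish on every ABC₁₁₁ invariant set (never computed) or on a VWI/critical-layer skeleton; resonant forces keep ν²‖u‖²≡const.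
sources: HoangJolly2024, arXiv:2402.13346 §4.2 (‖v_n‖≤|g|) and Thm 4.7 (3-D: expansions in D(A^s), s<1/2, no equations for v), FoiasHoangJolly2024, PodviginaPouquet1994, HallSherwin2010, Newcomb1959
[crux] SUB-GRASHOF CEILING OVER STEADY STATES of the GP force (card conjecture F1, rung 1 of the
energy ladder; the first statement that separates a FRUSTRATED force from a resonant one; NECESSARY
for GPEnergyCeiling since smooth steady states are global Leray–Hopf solutions with meanEnergy =
‖u‖² — isGlobalLerayHopf_of_isClassicalNSSolutionOn_holds +
Temam1979_steadyWeakSolution_smooth_holds). Statement: ∀ c>0 ∃ ν₀>0 ∀ ν∈(0,ν₀) ∀ u ∈ V steady weak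
solution of NS_ν(f_GP) (Torus.IsSteadyWeakSolution, u : energySpace (Fin 3)): ν²‖u‖²_{L²} ≤ c.
Equivalent (via support LaminarLimitCompactness, steady set compact at each ν) to: every strong-L²
limit point U of {ν·u : u steady state of NS_ν(f_GP), ν→0} is 0, i.e. in the language of
HoangJolly2024/FoiasHoangJolly2024 (v_n = u_n/(νκ₀G_n)) the leading Grashof-order term v vanishes on
EVERY steady branch of the GP force. TWO-LAYER PLAN (tenure split once LaminarLimitCompactness
lands; glue = that lemma): candidates U are H¹ steady weak Euler states with ‖∇U‖² ≤ (f_GP,U), hence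
with non-zero first-shell projection; (a) BeltramiSkeletonExclusion — U in the ±2π curl eigenspace
(6-dim ABC family): next-order solvability f_GP − c·4π²U ∈ closure R -/
@[route_item "route-AnomalousDissipation-FrustratedForces"]
def GPSteadySubGrashof : Prop :=
  ∀ c : ℝ, 0 < c → ∃ ν₀ : ℝ, 0 < ν₀ ∧ ∀ ν : ℝ, 0 < ν → ν < ν₀ → ∀ u : Literature.Analysis.FunctionSpaces.Torus.energySpace (Fin 3), (u : MeasureTheory.Lp (EuclideanSpace ℝ (Fin 3)) 2 (MeasureTheory.volume : MeasureTheory.Measure (UnitAddTorus (Fin 3)))) ∈ Literature.Analysis.FunctionSpaces.Torus.energySpaceV (Fin 3) → Literature.Analysis.FluidPDE.Torus.IsSteadyWeakSolution ν (fun x : UnitAddTorus (Fin 3) => (Literature.Analysis.FluidPDE.Torus.stokesMode (Pi.single (2 : Fin 3) (1 : ℤ)) (EuclideanSpace.single (0 : Fin 3) (1 : ℝ)) false x + Literature.Analysis.FluidPDE.Torus.stokesMode (Pi.single (0 : Fin 3) (1 : ℤ)) (EuclideanSpace.single (1 : Fin 3) (1 : ℝ)) false x + Literature.Analysis.FluidPDE.Torus.stokesMode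 (Pi.single (1 : Fin 3) (1 : ℤ)) (EuclideanSpace.single (2 : Fin 3) (1 : ℝ)) false x : EuclideanSpace ℝ (Fin 3))) u → ν ^ 2 * ‖u‖ ^ 2 ≤ c

/-- item stmt-AnomalousDissipation-13924 · crux · rank 3 · open · by planner
why it might fail: A hot-AND-loud branch kills it: E≍ν^{-2a}, a≥1/2 with ⟨(f,u)⟩↛0 — a=1 resonant skeleton (=¬#2; the Kolmogorov control is loud AND hot) or an off-ladder a∈[1/2,1) unsteady/isola state; nothing in print bounds energy by dissipation for any f≠0 (DoeringFoias2002: ε by U only); 2-D: loud⇒hot.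
sources: DoeringFoias2002, FoiasManleyRosaTemam2001, book:foias2001-navier-stokes-equations-turbulence PDF p.105 (13.11)-(13.12), AlexakisDoering2006PLA, ChildressKerswellGilbert2001, Cheskidov2023
[crux] LOUD-SELECTIVE ν-UNIFORM ENERGY CEILING ON H FOR THE GP FORCE (route choice 2026-08-15;
replaces the universal zero-mean ceiling GPEnergyCeilingZ stmt-10420 as hypothesis hC of the
deciding theorem closes : GPForceAdmissible → GPLoudEnergyCeilingZ → GPLoudFamilyZ →
AnomalousDissipation): ∀ ε₀ > 0 ∃ E ∀ ν ∈ (0,1] ∀ zero-mean datum u₀ (Torus.HasZeroMean u₀) ∀ global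
Leray–Hopf u of NS_ν(f_GP): meanDissipation ν u ≥ ε₀ → meanEnergy u ≤ E. 'For the frustrated force,
sustained dissipation costs bounded energy': with GPLoudFamilyZ (ε₀ := ε) it is literally
Kolmogorov's β = εℓ/U³ ≥ β₀ > 0 along the loud family, and closes is 7 lines (planner glue.lean;
Sketch.lean closes' rc 0, axioms propext/Classical.choice/Quot.sound). WHY THIS FORM. A ceiling over
ALL zero-mean LH solutions dies from ANY unbounded-energy invariant branch (a > 0), and the hub's
Galerkin census of the GP steady variety (kit j001684/j001712/j001732, card
big-dodgers-odd-puiseux-ladder, routed to MirrorVariety) finds warm QUIET runaway ends of the Stokes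
arc, ‖u‖ ≍ ν^{-1/3} with loudness ×0.80 per octave, at K² ∈ {2,3,4,5,8,9} (bounded quiet dodger ends
at K² ∈ {6,11,12,14}; continuum fate open); warm wakes and dod -/
@[route_item "route-AnomalousDissipation-FrustratedForces", crux (experiment := "instrument: kit jobs cited as sources kit:j001684/j001712/j001732 (card big-dodgers-odd-puiseux-ladder: Galerkin census of the GP steady variety)") (source := "ledger wanted_by.sources on stmt-AnomalousDissipation-13924, 2026-09-01")]
def GPLoudEnergyCeilingZ : Prop :=
  ∀ ε₀ : ℝ, 0 < ε₀ → ∃ E : ℝ, ∀ ν : ℝ, 0 < ν → ν ≤ 1 → ∀ (u₀ : UnitAddTorus (Fin 3) → EuclideanSpace ℝ (Fin 3)) (u : ℝ → UnitAddTorus (Fin 3) → EuclideanSpace ℝ (Fin 3)), Literature.Analysis.FunctionSpaces.Torus.HasZeroMean u₀ → Literature.Analysis.FluidPDE.Torus.IsGlobalLerayHopf ν (fun _ => (fun x : UnitAddTorus (Fin 3) => (Literature.Analysis.FluidPDE.Torus.stokesMode (Pi.single (2 : Fin 3) (1 : ℤ)) (EuclideanSpace.single (0 : Fin 3) (1 :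 ℝ)) false x + Literature.Analysis.FluidPDE.Torus.stokesMode (Pi.single (0 : Fin 3) (1 : ℤ)) (EuclideanSpace.single (1 : Fin 3) (1 : ℝ)) false x + Literature.Analysis.FluidPDE.Torus.stokesMode (Pi.single (1 : Fin 3) (1 : ℤ)) (EuclideanSpace.single (2 : Fin 3) (1 : ℝ)) false x : EuclideanSpace ℝ (Fin 3)))) u₀ u → ε₀ ≤ Literature.Analysis.FluidPDE.meanDissipation ν u → Literature.Analysis.FluidPDE.meanEnergy u ≤ E

/-- item stmt-AnomalousDissipation-10436 · crux · rank 4 · open · by planner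
why it might fail: f_GP may be quiet: every zero-mean LH family may have ν_j⟨‖∇u_j‖²⟩→0 (bounded-energy families decorrelate from f); no loud LH family is known for ANY fixed ν-independent force (Cheskidov2023 §1.2; Thm 1.3 needs f^{ν_j}→f); the 2-D analogue is false (AlexakisDoering2006).
sources: Cheskidov2023, arXiv:2311.04182 §1.2 and Thm 1.3, BrueDeLellis2023, AlexakisDoering2006PLA, BorueOrszag1996, Literature.Barriers.AnomalousDissipation.Cheskidov2023_thm13_not_forceRobustNoAnomaly
[crux] LOUDNESS FOR THE GP FORCE WITH ZERO-MEAN DATA (supersedes GPLoudFamily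
stmt-AnomalousDissipation-2980 as hypothesis hL of the deciding theorem closes : GPForceAdmissible →
GPEnergyCeilingZ → GPLoudFamilyZ → AnomalousDissipation — the repaired ceiling GPEnergyCeilingZ
bounds only zero-mean trajectories, so the loud family must live in the physical phase space H;
GPLoudFamilyZ → GPLoudFamily verbatim, planner Sketch.lean loudZ_imp_loud). ∃ ε > 0, ν_j → 0 with
ν_j ∈ (0,1], ZERO-MEAN data u₀_j (Torus.HasZeroMean (u₀ j)) and global Leray–Hopf u_j of
NS_{ν_j}(f_GP) with meanDissipation (ν_j) (u_j) = limsup_T T⁻¹∫₀ᵀ ν_j‖∇u_j‖² ≥ ε. Existential in the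
family (energy is handled universally by GPEnergyCeilingZ, so ANY zero-mean loud LH family of f_GP
fires closes). Every natural witness is zero-mean anyway: LH only gives meanDissipation ≤ ⟨f_GP,u⟩
(Correlation 0446), so a proof needs smooth/steady/periodic witnesses (energy equality; e.g. a loud
GP steady or UPO branch realised as LH via isGlobalLerayHopf_of_isClassicalNSSolutionOn_holds —
mean-zero by construction) or a direct enstrophy floor for Hopf solutions from data in H. Mechanisms
on offer in the hub: euler-coercive-force, lag -/
@[route_item "route-AnomalousDissipation-FrustratedForces", crux]
def GPLoudFamilyZ : Prop :=
  ∃ ε : ℝ, 0 < ε ∧ ∃ (ν : ℕ → ℝ) (u₀ : ℕ → UnitAddTorus (Fin 3) → EuclideanSpace ℝ (Fin 3)) (u : ℕ → ℝ → UnitAddTorus (Fin 3) → EuclideanSpace ℝ (Fin 3)), (∀ j, 0 < ν j ∧ ν j ≤ 1) ∧ Filter.Tendsto ν Filter.atTop (nhds 0) ∧ (∀ j, Literature.Analysis.FunctionSpaces.Torus.HasZeroMean (u₀ j)) ∧ (∀ j, Literature.Analysis.FluidPDE.Torus.IsGlobalLerayHopf (ν j) (fun _ => (fun x : UnitAddTorus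 (Fin 3) => (Literature.Analysis.FluidPDE.Torus.stokesMode (Pi.single (2 : Fin 3) (1 : ℤ)) (EuclideanSpace.single (0 : Fin 3) (1 : ℝ)) false x + Literature.Analysis.FluidPDE.Torus.stokesMode (Pi.single (0 : Fin 3) (1 : ℤ)) (EuclideanSpace.single (1 : Fin 3) (1 : ℝ)) false x + Literature.Analysis.FluidPDE.Torus.stokesMode (Pi.single (1 : Fin 3) (1 : ℤ)) (EuclideanSpace.single (2 : Fin 3) (1 : ℝ)) false x : EuclideanSpace ℝ (Fin 3)))) (u₀ j) (u j)) ∧ ∀ j, ε ≤ Literature.Analysis.FluidPDE.meanDissipation (ν j) (u j)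

/-- item stmt-AnomalousDissipation-10437 · support · rank 9 · open · by planner
sources: FoiasManleyRosaTemam2001, Literature.Analysis.FluidPDE.exists_timeAverageMeasure_holds, Literature.Analysis.FluidPDE.timeAverage_isStationary_holds, Summit.AnomalousDissipation.AnomalousDissipation.Theorems.FrustratedForcesEnsembleCeilingBridge_refuted
[support] REPAIRED EnsembleCeilingBridge (stmt-AnomalousDissipation-2984 refuted-MISSTATED by
Theorems.FrustratedForcesEnsembleCeilingBridge_refuted: f = 0, ν = 1, E = 0 and the constant drift
datum u ≡ e₀; the refuter's FIX line = zero-mean data). SSS CEILING ⇒ LERAY–HOPF CEILING AT FIXED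
VISCOSITY ON H (general smooth div-free mean-zero f; the bridge by which provers of GPEnergyCeilingZ
may work with stationary statistical solutions, the card's native language): if every stationary
statistical solution μ of (ν, f) with integrable energy has ensembleEnergy μ ≤ E, then every global
Leray–Hopf solution u of NS_ν(f) from a ZERO-MEAN datum u₀ has meanEnergy u ≤ E. Proof (~400–600
lines; every named fact used is PROVED in tree): (0) zero mean is conserved
(IsGlobalLerayHopf.integral_inner_const_eq), so u(t) is mean-zero and divergence-free for t ≥ 0 and
lifts to U : ℝ → H = energySpace (Fin 3) with U t = u t a.e.
(IsGlobalLerayHopf.aestronglyMeasurable_lift, TimeAverageMeasureExistence.lean); (1) absorbing ball: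
R := sup_{t≥0} ‖u(t)‖ < ∞ from energy_ineq_ae + Poincaré (cf. Correlation support
AbsorbingBallLHTorus stmt-0447; FMRT App. II.A (A.41)–(A.42)); (2) choose a GeneralizedLimit Λ -/
@[route_item "route-AnomalousDissipation-FrustratedForces"]
def EnsembleCeilingBridgeZ : Prop :=
  ∀ f : UnitAddTorus (Fin 3) → EuclideanSpace ℝ (Fin 3), Literature.Analysis.FunctionSpaces.Torus.IsSmooth f → Literature.Analysis.FunctionSpaces.Torus.IsDivFree f → Literature.Analysis.FunctionSpaces.Torus.HasZeroMean f → ∀ (ν E : ℝ), 0 < ν → (∀ μ : MeasureTheory.Measure (Literature.Analysis.FunctionSpaces.Torus.energySpace (Fin 3)), Literature.Analysis.FluidPDE.Torus.IsStationaryStatisticalSolution ν f μ → MeasureTheory.Integrable (fun u => ‖u‖ ^ 2) μ → Literature.Analysis.FluidPDE.Torus.ensembleEnergy μ ≤ E) → ∀ (u₀ : UnitAddTorus (Fin 3) → EuclideanSpace ℝ (Fin 3)) (u : ℝ → UnitAddTorus (Fin 3) → EuclideanSpace ℝ (Fin 3)), Literature.Analysis.FunctionSpaces.Torus.HasZeroMean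 u₀ → Literature.Analysis.FluidPDE.Torus.IsGlobalLerayHopf ν (fun _ => f) u₀ u → Literature.Analysis.FluidPDE.meanEnergy u ≤ E

/-- item stmt-AnomalousDissipation-14126 · support · rank 9 · open · by planner
[support] GLUE INTO THE TARGET (route choice 2026-08-16; repairs the operator hold
`route.target-unreachable: no item concludes the target GPZerothLaw`). The two loud cruxes give
thesis X for the pinned Galloway–Proctor force: GPLoudEnergyCeilingZ (#3, loud-selective ν-uniform
energy ceiling on H) → GPLoudFamilyZ (#4, a loud zero-mean Leray–Hopf family with ν_j → 0 in (0,1])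
→ GPZerothLaw (X: ν_j → 0, global Leray–Hopf u_j of NS_{ν_j}(f_GP), sup_j meanEnergy ≤ E, inf_j
meanDissipation ≥ ε > 0). PROVABLE NOW (6 lines, planner Sketch.lean
gpLoudCruxesGiveZerothLaw_proof, rc 0, axioms propext/Classical.choice/Quot.sound): take ε, ν, u₀, u
from #4; E from #3 at ε₀ := ε applied at each j with 0 < ν_j ≤ 1, HasZeroMean (u₀ j), the LH
property and ε ≤ meanDissipation; X forgets ν_j ≤ 1 and the zero mean. With
GPZerothLawClosesStatement it factors the deciding theorem: closes hF hC hL =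
GPZerothLawClosesStatement hF (GPLoudCruxesGiveZerothLaw hC hL). [deps: GPLoudEnergyCeilingZ,
GPLoudFamilyZ, GPZerothLaw] [difficulty: provable-now] -/
@[route_item "route-AnomalousDissipation-FrustratedForces"]
def GPLoudCruxesGiveZerothLaw : Prop :=
  GPLoudEnergyCeilingZ → GPLoudFamilyZ → GPZerothLaw

-- earlier GPZerothLawClosesStatement (stmt-AnomalousDissipation-14127, replaced 2026-08-16T03:24:25Z -> stmt-AnomalousDissipation-14432): retired by None — GPForceAdmissible → GPZerothLaw → _root_.AnomalousDissipation
/-- item stmt-AnomalousDissipation-14432 · support · rank 9 · open · by planner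
[support] GLUE OUT OF THE TARGET — frame statement #1, X → Statement (route choice 2026-08-16;
restated the same day from `GPForceAdmissible → GPZerothLaw → AnomalousDissipation`, which the gate
rendered ABOVE the decl GPForceAdmissible (support items are laid out in item-id order) and
therefore blocked; the restated form has no route-local hypothesis). Thesis X for the pinned
Galloway–Proctor force (GPZerothLaw: ν_j → 0, global Leray–Hopf u_j of NS_{ν_j}(f_GP), sup_j
meanEnergy ≤ E, inf_j meanDissipation ≥ ε > 0) implies the summit AnomalousDissipation :=
Literature.Turb.ZerothLaw by ∃-introduction with f := f_GP — GPZerothLaw is verbatim the body of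
ZerothLaw after its three admissibility conjuncts IsSmooth f ∧ IsDivFree f ∧ HasZeroMean f, so the
whole content of the item is the admissibility of f_GP = sin(2πx₃)e₁ + sin(2πx₁)e₂ + sin(2πx₂)e₃
(inline sum of three Stokes modes), i.e. item GPForceAdmissible (~100–200 lines: IsSmooth.add of
stokesMode smoothness; divergence-free since each mode has k·a = 0; zero mean since ∫ sin(2π x_j) =
0). PROVABLE NOW: planner Sketch2.lean proves GPForceAdmissible → (GPZerothLaw →
AnomalousDissipation) in 4 lines (obtain ⟨hs, hd, hm⟩ := hF; dsimp -/
@[route_item "route-AnomalousDissipation-FrustratedForces"]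
def GPZerothLawClosesStatement : Prop :=
  GPZerothLaw → _root_.AnomalousDissipation

/-- item stmt-AnomalousDissipation-2981 · support · rank 9 · open · by planner
[support] f_GP is smooth, divergence-free and mean-zero (Torus.IsSmooth / IsDivFree / HasZeroMean of
the inline sum of three Stokes modes sin(2πx₃)e₁ + sin(2πx₁)e₂ + sin(2πx₂)e₃, 0-indexed: component i
depends only on x_{i-1}). Provable now (~100–200 lines): smoothness from isSmooth_mFourier /
stokesMode continuity + IsSmooth.add; divergence: ∂_i of component i vanishes since stokesMode k a
false with k·a = 0 (Pi.single j 1 · EuclideanSpace.single i 1 = 0 for i ≠ j); zero mean: ∫ sin(2π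
x_j) = 0 (integral of (mFourier k).im, k ≠ 0). First hypothesis of the Assembly; also gives f_GP ∈
smoothSolenoidal hence MemLp.toLp f_GP ∈ energySpace for SSS-level work. Sources:
ConstantinFoias1988 Ch. 4 (4.13)–(4.14) (Stokes eigenfields solenoidal iff k·a = 0);
StokesTorus.lean stokesMode_apply. -/
@[route_item "route-AnomalousDissipation-FrustratedForces", crux]
def GPForceAdmissible : Prop :=
  Literature.Analysis.FunctionSpaces.Torus.IsSmooth (fun x : UnitAddTorus (Fin 3) => (Literature.Analysis.FluidPDE.Torus.stokesMode (Pi.single (2 : Fin 3) (1 : ℤ)) (EuclideanSpace.single (0 : Fin 3) (1 : ℝ)) false x + Literature.Analysis.FluidPDE.Torus.stokesMode (Pi.single (0 : Fin 3) (1 : ℤ)) (EuclideanSpace.single (1 : Fin 3) (1 : ℝ)) false x + Literature.Analysis.FluidPDE.Torus.stokesMode (Pi.single (1 : Fin 3) (1 : ℤ)) (EuclideanSpace.single (2 : Fin 3) (1 : ℝ)) false x : EuclideanSpace ℝ (Fin 3))) ∧ Literature.Analysis.FunctionSpaces.Torus.IsDivFree (fun x : UnitAddTorus (Fin 3) =>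 (Literature.Analysis.FluidPDE.Torus.stokesMode (Pi.single (2 : Fin 3) (1 : ℤ)) (EuclideanSpace.single (0 : Fin 3) (1 : ℝ)) false x + Literature.Analysis.FluidPDE.Torus.stokesMode (Pi.single (0 : Fin 3) (1 : ℤ)) (EuclideanSpace.single (1 : Fin 3) (1 : ℝ)) false x + Literature.Analysis.FluidPDE.Torus.stokesMode (Pi.single (1 : Fin 3) (1 : ℤ)) (EuclideanSpace.single (2 : Fin 3) (1 : ℝ)) false x : EuclideanSpace ℝ (Fin 3))) ∧ Literature.Analysis.FunctionSpaces.Torus.HasZeroMean (fun x : UnitAddTorus (Fin 3) => (Literature.Analysis.FluidPDE.Torus.stokesMode (Pi.single (2 : Fin 3) (1 : ℤ)) (EuclideanSpace.single (0 : Fin 3) (1 : ℝ)) false x + Literature.Analysis.FluidPDE.Torus.stokesMode (Pi.single (0 : Fin 3) (1 : ℤ)) (EuclideanSpace.single (1 : Fin 3) (1 : ℝ)) false x + Literature.Analysis.FluidPDE.Torus.stokesMode (Pi.single (1 : Fin 3) (1 : ℤ)) (EuclideanSpace.single (2 : Fin 3) (1 : ℝ)) false x : EuclideanSpace ℝ (Fin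 3)))

/-- item stmt-AnomalousDissipation-2982 · support · rank 9 · open · by planner
[support] LAMINAR-LIMIT COMPACTNESS (card (R), steady version; general smooth div-free mean-zero f;
the glue of the future split of GPSteadySubGrashof). For steady weak solutions u_n ∈ V of
NS_{ν_n}(f), ν_n → 0: the rescaled fields ν_n·u_n have a subsequence converging strongly in H (L²)
to some U with U ∈ V, IsSteadyWeakSolution 0 0 U (steady weak Euler, unforced: ∫(U⊗U):∇w = 0 for all
smooth div-free mean-zero w) and the energy–work inequality ‖∇U‖² (spectral eGradNormSq, toReal) ≤
(U,f) — so U = 0 or U is an H¹ steady Euler skeleton POSITIVELY RESONANT with f ((f,U) ≥ 4π²‖U‖² by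
Poincaré). Proof (~400–600 lines, all ingredients in tree): steady energy equality ν‖∇u‖² = (f,u)
(Temam1979_steadyWeakSolution_energy_eq_holds) and Poincaré give ‖∇(νu)‖ ≤ ‖f‖/(2π) (V-bounded; =
HoangJolly2024 eq. before Thm 4.7 '‖v_n‖ ≤ |g|'); Rellich on T³ (EnergySpaceRellich.lean) gives the
L²-convergent subsequence and U ∈ V by weak lower semicontinuity of the H¹ seminorm; multiply the
weak form nsGeneratorPairing ν f u w = 0 by ν²: ν²(f,w) + ν³(u,Δw) + inertialPairing (νu) w = 0 and
pass to the limit (inertialPairing is continuous on L² for smooth w: SteadyNavierStokesWeakForm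
tools) ⇒ inertialPair -/
@[route_item "route-AnomalousDissipation-FrustratedForces"]
def LaminarLimitCompactness : Prop :=
  ∀ f : UnitAddTorus (Fin 3) → EuclideanSpace ℝ (Fin 3), Literature.Analysis.FunctionSpaces.Torus.IsSmooth f → Literature.Analysis.FunctionSpaces.Torus.IsDivFree f → Literature.Analysis.FunctionSpaces.Torus.HasZeroMean f → ∀ (ν : ℕ → ℝ) (u : ℕ → Literature.Analysis.FunctionSpaces.Torus.energySpace (Fin 3)), (∀ n, 0 < ν n) → Filter.Tendsto ν Filter.atTop (nhds 0) → (∀ n, (u n : MeasureTheory.Lp (EuclideanSpace ℝ (Fin 3)) 2 (MeasureTheory.volume : MeasureTheory.Measure (UnitAddTorus (Fin 3)))) ∈ Literature.Analysis.FunctionSpaces.Torus.energySpaceV (Fin 3) ∧ Literature.Analysis.FluidPDE.Torus.IsSteadyWeakSolution (ν n) f (u n)) → ∃ φ : ℕ → ℕ, StrictMono φ ∧ ∃ U : Literature.Analysis.FunctionSpaces.Torus.energySpace (Fin 3), Filter.Tendsto (fun n => ν (φ n) • u (φ n)) Filter.atTop (nhds U) ∧ (U : MeasureTheory.Lp (EuclideanSpace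 ℝ (Fin 3)) 2 (MeasureTheory.volume : MeasureTheory.Measure (UnitAddTorus (Fin 3)))) ∈ Literature.Analysis.FunctionSpaces.Torus.energySpaceV (Fin 3) ∧ Literature.Analysis.FluidPDE.Torus.IsSteadyWeakSolution 0 0 U ∧ (Literature.Analysis.FunctionSpaces.Torus.eGradNormSq ((U : MeasureTheory.Lp (EuclideanSpace ℝ (Fin 3)) 2 (MeasureTheory.volume : MeasureTheory.Measure (UnitAddTorus (Fin 3)))) : UnitAddTorus (Fin 3) → EuclideanSpace ℝ (Fin 3))).toReal ≤ Literature.Analysis.FluidPDE.Torus.pairing (U : MeasureTheory.Lp (EuclideanSpace ℝ (Fin 3)) 2 (MeasureTheory.volume : MeasureTheory.Measure (UnitAddTorus (Fin 3)))) f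

/-- item stmt-AnomalousDissipation-2983 · support · rank 9 · open · by planner
[support] RESCALED RESONANT SKELETON AT THE STATISTICAL LEVEL (card deliverable R1; general smooth
div-free mean-zero f; reusable by Ensemble (calibration of 0216), Neg ('unbounded energy must look
like resonance with a skeleton') and refuters grading energy cruxes; no consumer inside this route's
assembly — low priority). If stationary statistical solutions μ_n of NS_{ν_n}(f) (FMRT Def. IV.1.2 =
Torus.IsStationaryStatisticalSolution), ν_n → 0, have Grashof-scale energy ν_n²·ensembleEnergy μ_n ≥
c² > 0, then there is a probability measure μ̄ on H which is a stationary statistical solution of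
UNFORCED EULER in the same Foias–Prodi sense (IsStationaryStatisticalSolution 0 0 μ̄: finite mean
enstrophy — the H¹ condition —, ∫ inertialPairing u (Φ.grad u) dμ̄ = 0 for every cylindrical Φ,
trivial shell inequality), with integrable energy, ensembleEnergy μ̄ = 1 and the resonance identity
c·(ensembleEnstrophy μ̄).toReal ≤ ∫ (u,f) dμ̄ (hence ∫(u,f)dμ̄ ≥ 4π²c). Proof (~600–900 lines): A_n
:= (ensembleEnergy μ_n)^{1/2} ≥ c/ν_n; push μ_n forward by u ↦ u/A_n: unit energy; supports lie in
the ball ‖v‖ ≤ ‖f‖/(4π²ν_nA_n) ≤ ‖f‖/(4π²c) by the shell energy inequality (FMRT IV (1.31)–(1.34),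
p.198; PR -/
@[route_item "route-AnomalousDissipation-FrustratedForces"]
def RescaledSkeletonSSS : Prop :=
  ∀ f : UnitAddTorus (Fin 3) → EuclideanSpace ℝ (Fin 3), Literature.Analysis.FunctionSpaces.Torus.IsSmooth f → Literature.Analysis.FunctionSpaces.Torus.IsDivFree f → Literature.Analysis.FunctionSpaces.Torus.HasZeroMean f → ∀ c : ℝ, 0 < c → ∀ (ν : ℕ → ℝ) (μ : ℕ → MeasureTheory.Measure (Literature.Analysis.FunctionSpaces.Torus.energySpace (Fin 3))), (∀ n, 0 < ν n) → Filter.Tendsto ν Filter.atTop (nhds 0) → (∀ n, Literature.Analysis.FluidPDE.Torus.IsStationaryStatisticalSolution (ν n) f (μ n)) → (∀ n, MeasureTheory.Integrable (fun u => ‖u‖ ^ 2) (μ n)) → (∀ n, c ^ 2 ≤ (ν n) ^ 2 * Literature.Analysis.FluidPDE.Torus.ensembleEnergy (μ n)) → ∃ μbar : MeasureTheory.Measure (Literature.Analysis.FunctionSpaces.Torus.energySpace (Fin 3)), Literature.Analysis.FluidPDE.Torus.IsStationaryStatisticalSolution 0 0 μbar ∧ MeasureTheory.Integrable (fun u =>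 ‖u‖ ^ 2) μbar ∧ Literature.Analysis.FluidPDE.Torus.ensembleEnergy μbar = 1 ∧ c * (Literature.Analysis.FluidPDE.Torus.ensembleEnstrophy μbar).toReal ≤ ∫ u, Literature.Analysis.FluidPDE.Torus.pairing (u : MeasureTheory.Lp (EuclideanSpace ℝ (Fin 3)) 2 (MeasureTheory.volume : MeasureTheory.Measure (UnitAddTorus (Fin 3)))) f ∂μbar

/-- item stmt-AnomalousDissipation-2985 · support · rank 9 · open · by planner
[support] LAMINAR CALIBRATION — THE RESONANT CONTROL (card U1 as corrected by the refuter audit: a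
Grashof-scale Dirac/steady state needs f Stokes-eigen AND Euler-steady). For the Kolmogorov shear
force f_K(x) = sin(2πx₂)e₁ (inline: stokesMode (Pi.single 1 1) (EuclideanSpace.single 0 1) false;
0-indexed sin(2πx₁)e₀) and every ν > 0, the laminar field u_ν = f_K/(4π²ν) defines U ∈ V ⊂ H (as the
L² class a.e. equal to u_ν) which is a steady weak solution of NS_ν(f_K) (−νΔu_ν = f_K, (u_ν·∇)u_ν =
0) with ν²‖U‖² = ‖f_K‖²/(16π⁴) = 1/(32π⁴) EXACTLY — so the analogue of GPSteadySubGrashof for f_K is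
false and the sub-Grashof ceiling is necessarily force-specific (frustration is doing the work).
Provable now (~150–250 lines): U := ⟨MemLp.toLp u_ν, smoothSolenoidal ⊂ energySpace⟩ (u_ν smooth,
div-free since it depends on x₁ only and points along e₀, mean-zero), MemSobolev 1 (trig
polynomial), weak form: ν∫⟪u_ν,Δw⟫ = ν∫⟪Δu_ν,w⟫ = −∫⟪f_K,w⟫ and inertialPairing u_ν w =
−∫⟪(u_ν·∇)u_ν, w⟫ = 0 (integration by parts on the torus, TorusCalculus), norm: ‖sin(2π·)‖²_{L²(T³)}
= 1/2. Twin in tree (2-D): Literature.Barriers.AnomalousDissipation.Marchioro1986_globalAttraction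
(marchioroLaminarState). Sourc -/
@[route_item "route-AnomalousDissipation-FrustratedForces"]
def LaminarCalibration : Prop :=
  ∀ ν : ℝ, 0 < ν → ∃ U : Literature.Analysis.FunctionSpaces.Torus.energySpace (Fin 3), (U : MeasureTheory.Lp (EuclideanSpace ℝ (Fin 3)) 2 (MeasureTheory.volume : MeasureTheory.Measure (UnitAddTorus (Fin 3)))) ∈ Literature.Analysis.FunctionSpaces.Torus.energySpaceV (Fin 3) ∧ Literature.Analysis.FluidPDE.Torus.IsSteadyWeakSolution ν (fun x : UnitAddTorus (Fin 3) => (Literature.Analysis.FluidPDE.Torus.stokesMode (Pi.single (1 : Fin 3) (1 : ℤ)) (EuclideanSpace.single (0 : Fin 3) (1 : ℝ)) false x : EuclideanSpace ℝ (Fin 3))) U ∧ ((U : MeasureTheory.Lp (EuclideanSpace ℝ (Fin 3)) 2 (MeasureTheory.volume : MeasureTheory.Measure (UnitAddTorus (Fin 3)))) : UnitAddTorus (Fin 3) → EuclideanSpace ℝ (Fin 3)) =ᵐ[MeasureTheory.volume] (fun x : UnitAddTorus (Fin 3) => (4 * Real.pi ^ 2 * ν)⁻¹ • (Literature.Analysis.FluidPDE.Torus.stokesMode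 (Pi.single (1 : Fin 3) (1 : ℤ)) (EuclideanSpace.single (0 : Fin 3) (1 : ℝ)) false x : EuclideanSpace ℝ (Fin 3))) ∧ ν ^ 2 * ‖U‖ ^ 2 = (32 * Real.pi ^ 4)⁻¹

-- earlier Assembly (stmt-AnomalousDissipation-10541, replaced 2026-08-15T23:14:25Z -> stmt-AnomalousDissipation-13923): retired by None — GPForceAdmissible → GPEnergyCeilingZ → GPLoudFamilyZ → _root_.AnomalousDissipation
-- earlier Assembly (stmt-AnomalousDissipation-2977, replaced 2026-08-15T16:18:07Z -> stmt-AnomalousDissipation-10541): retired by None — (Literature.Analysis.FunctionSpaces.Torus.IsSmooth (fun x : UnitAddTorus (Fin 3) => (Literature.Analysis.FluidPDE.Torus.stokesMode (Pi.single (2 : Fin 3) (1 : ℤ)) (EuclideanSpace.single (0 : Fin 3) (1 : ℝ)) false x + Literature.Analysis.FluidPDE.Torus.stokesMode (P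
/-- item stmt-AnomalousDissipation-13923 · assembly · rank 1 · open · by planner
[assembly] GPForceAdmissible → GPLoudEnergyCeilingZ → GPLoudFamilyZ → AnomalousDissipation (decl
names; restated 2026-08-15 at the route choice: hypothesis 2 is now the LOUD-SELECTIVE ceiling
instead of the universal GPEnergyCeilingZ). Exactly the type of the deciding theorem `closes`
rendered below (planner glue.lean; Sketch.lean closes' / assemblyR_holds rc 0, axioms
propext/Classical.choice/Quot.sound), so it is PROVABLE NOW by `fun hF hC hL => closes hF hC hL` (or
the 7 tactic lines of closes). -/
@[route_item "route-AnomalousDissipation-FrustratedForces"]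
def Assembly : Prop :=
  GPForceAdmissible → GPLoudEnergyCeilingZ → GPLoudFamilyZ → _root_.AnomalousDissipation

-- records of items no longer active in this route (dropped / restated):
-- earlier GPEnergyCeiling (stmt-AnomalousDissipation-2979, dropped 2026-08-15T16:20:59Z): refuted by Summit.AnomalousDissipation.AnomalousDissipation.Theorems.FrustratedForcesGPEnergyCeiling_refuted @ ffffe9673610 — ∃ E : ℝ, ∀ ν : ℝ, 0 < ν → ν ≤ 1 → ∀ (u₀ : UnitAddTorus (Fin 3) → EuclideanSpace ℝ (Fin 3)) (u : ℝ → UnitAddTorus (Fin 3) → EuclideanSpace ℝ (Fin 3)), Literature.Analysis.FluidPDE.Torus.I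
-- earlier EnsembleCeilingBridge (stmt-AnomalousDissipation-2984, dropped 2026-08-15T16:20:59Z): refuted by Summit.AnomalousDissipation.AnomalousDissipation.Theorems.FrustratedForcesEnsembleCeilingBridge_refuted — ∀ f : UnitAddTorus (Fin 3) → EuclideanSpace ℝ (Fin 3), Literature.Analysis.FunctionSpaces.Torus.IsSmooth f → Literature.Analysis.FunctionSpaces.Torus.IsDivFree f → Literature.Analysis.Funct

/-! D-0027 §2.1 — DECIDING THEOREM (planner-authored via `route open/edit --closes-file`; by planner-rchoice-AnomalousDissipation-Frustrate-e6e54d4b-0 2026-08-15T23:14:25Z):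
its hypotheses are this route's items and its conclusion the sub-problem Statement (glue_lint), and it elaborates with this file. -/

@[closes "route-AnomalousDissipation-FrustratedForces"] theorem closes (hF : GPForceAdmissible) (hC : GPLoudEnergyCeilingZ) (hL : GPLoudFamilyZ) :
    _root_.AnomalousDissipation := by
  obtain ⟨hs, hd, hm⟩ := hF
  obtain ⟨ε, hε, ν, u₀, u, hν, hν0, hz, hLH, hεj⟩ := hL
  obtain ⟨E, hE⟩ := hC ε hε
  dsimp only [_root_.AnomalousDissipation, Literature.Turb.ZerothLaw]
  exact ⟨_, hs, hd, hm, ν, u₀, u, fun j => (hν j).1, hν0, hLH,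
    ⟨E, fun j => hE (ν j) (hν j).1 (hν j).2 (u₀ j) (u j) (hz j) (hLH j) (hεj j)⟩, ε, hε, hεj⟩

end Summit.AnomalousDissipation.AnomalousDissipation.Theses.FrustratedForces
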